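import Mathlib
import HarnessLib

/-!
# Route `ThermalDescent`, deciding crux `ZeroTemperatureFloors` (stmt-QuantumFields-25390):
# BC5 material — the Hamiltonian caricature of the zero-temperature floor DECIDED, and the
# limit-floor lemma the fixed-cut-off rung is assembled with

Tribunal-w seat `ym-td-bc5w-1` (planner; R3/RECORD framing; helper file `--supports` the crux, closes
nothing).  The deciding crux `Theses.ThermalDescent.ZeroTemperatureFloors` asks, for some faithful lattice
representation `r` and unit map `a → 0`, for ONE slab test function `v` and ONE `ε > 0` with
`ε ≤ Qrp_β((2L+1)³ × 2^k(2L+1))(a(β), v)` (reflection-positive smeared plaquette two-point function on the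
long cylinders) UNIFORMLY in `β ≥ β₅`, `a(β)·L ≥ Λ₅`, `k ≥ k₀(β, L)`.  The rung-R2a target it closes,
`BalabanLadder.NT` clause (i), is the same kind of floor on the HYPERCUBIC tori `(2L+1)⁴` — it has no
zero-temperature parameter `k`.

The BC5 first rung of the crux (plan-only; workfile `Cruxes/ZeroTemperatureFloors/Lines/rung.lean`,
decl `ZeroTemperatureFloorsPointwise`) is the crux with `v, δ₁, δ₂, ε` chosen AFTER `(β, L)`: the floor at
FIXED cut-off and fixed spatial box, still uniform in `k` — i.e. exactly the piece of the crux NT does not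
contain (survival of the reflection floor in the zero-temperature limit `T = 2^k(2L+1) → ∞`), separated
from the piece it shares with NT (uniformity as `β → ∞`, not claimed).  Its proof route is the Hamiltonian
one the thesis imports — transfer matrix on `(2L+1)³` (tree `exists_spectralData_wilsonFinTorusPartition`,
`wilsonTorusTransferMatrix`), Perron–Frobenius/Jentzsch simplicity of the top eigenvalue of the strictly
positive Wilson kernel, two-insertion trace formula — in two named inputs: (S1) the thermal limit of the
period-doubling chain exists, (S2) the limit (the vacuum reflection-positive two-point function) is
positive.

This file lands, sorry-free and definition-free:

§1 `eventually_floor_of_tendsto` — the assembly lemma `S1 ∧ S2 ⇒ eventual floor` used by the workfile's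
   `ZeroTemperatureFloorsPointwise_of`.
§2 The Hamiltonian caricature DECIDED.  A transfer matrix already diagonalised — eigenvalues
   `lam : Fin (n+1) → ℝ`, ground state `0`, `λ₀ > λᵢ ≥ 0` — and the matrix `b` of a slab observable in the
   eigenbasis; on the circle of period `N + m` (reflection separation `m`): `Z = Tr 𝕋ᴺ⁺ᵐ = Σᵢ λᵢᴺ⁺ᵐ`,
   `⟨B⟩ = Tr(b𝕋ᴺ⁺ᵐ)/Z = Σᵢ bᵢᵢλᵢᴺ⁺ᵐ/Z`, `⟨θB·B⟩ = Tr(b𝕋ᴺb𝕋ᵐ)/Z = Σᵢⱼ bᵢⱼbⱼᵢλᵢᴺλⱼᵐ/Z`,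
   `Cov = ⟨θB·B⟩ − ⟨B⟩²` (written out in every statement; no definitions).  THEOREMS: the thermal
   covariance converges, as `N → ∞`, to the vacuum two-point function `Σ_{j≠0} b₀ⱼbⱼ₀(λⱼ/λ₀)ᵐ`
   (`toyCov_tendsto` = the caricature of S1 with its limit identified); hence a positive floor for all large
   periods IFF the observable couples the ground state to an excited state of non-zero eigenvalue
   (`toy_floor_iff`; `toy_zeroTemperatureFloor` = S2 ⇒ floor, `toy_noFloor` = decoupled ⇒ no floor).  This
   is the kernel-visible witness that the zero-temperature clause of the crux has content of its own (it CAN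
   fail) and that the named technique delivers it when it holds; NT(i) has no one-operator caricature (its
   time extent is the spatial one).

Nothing here proves `ZeroTemperatureFloors`, `NT`, or the Yang–Mills mass gap: §2 is finite-dimensional
linear algebra and §1 is order topology on `ℝ`. [cite: Luscher1977; OsterwalderSeilerAnnPhys1978, §2–3;
Seiler1982]
-/

set_option autoImplicit false

noncomputable section

namespace Summit.QuantumFields.YangMills.Theorems.ThermalDescent

open Filter Topology

/-! ## §1 The assembly lemma of the rung: thermal limit exists ∧ limit positive ⇒ eventual floor -/

/-- If a real sequence converges and every limit is `≥ 2ε > 0`, then it is eventually `≥ ε`. [folklore] -/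
theorem eventually_floor_of_tendsto {f : ℕ → ℝ} {ε : ℝ} (hε : 0 < ε)
    (hlim : ∃ q : ℝ, Tendsto f atTop (𝓝 q)) (hq : ∀ q : ℝ, Tendsto f atTop (𝓝 q) → 2 * ε ≤ q) :
    ∃ k₀ : ℕ, ∀ k : ℕ, k₀ ≤ k → ε ≤ f k := by
  obtain ⟨q, hfq⟩ := hlim
  have h2 : 2 * ε ≤ q := hq q hfq
  have hev : ∀ᶠ k in atTop, ε < f k := (tendsto_order.1 hfq).1 ε (by linarith)
  obtain ⟨k₀, hk₀⟩ := eventually_atTop.1 hev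
  exact ⟨k₀, fun k hk => (hk₀ k hk).le⟩

/-! ## §2 The Hamiltonian caricature of the cylinder, decided

Eigenvalues `lam : Fin (n+1) → ℝ` of the transfer matrix (ground state index `0`), matrix `b` of the slab
observable in the eigenbasis; period `N + m`, reflection separation `m`.  The thermal covariance is
`(Σᵢⱼ bᵢⱼ bⱼᵢ λᵢᴺ λⱼᵐ)/(Σᵢ λᵢᴺ⁺ᵐ) − ((Σᵢ bᵢᵢ λᵢᴺ⁺ᵐ)/(Σᵢ λᵢᴺ⁺ᵐ))²`. -/

section Toy

variable {n : ℕ} {lam : Fin (n + 1) → ℝ} {b : Fin (n + 1) → Fin (n + 1) → ℝ}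

/-- `λᵢᵀ → [i = 0]` when `λ₀ = 1`, `0 ≤ λᵢ < 1` otherwise. [folklore] -/
theorem tendsto_pow_eigen (h1 : lam 0 = 1) (hnn : ∀ i, 0 ≤ lam i) (hgap : ∀ i, i ≠ 0 → lam i < 1)
    (i : Fin (n + 1)) :
    Tendsto (fun T : ℕ => lam i ^ T) atTop (𝓝 (if i = 0 then 1 else 0)) := by
  by_cases hi : i = 0
  · subst hi
    simp only [h1, one_pow, if_true]
    exact tendsto_const_nhds
  · simp only [hi, if_false]
    exact tendsto_pow_atTop_nhds_zero_of_lt_one (hnn i) (hgap i hi)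

/-- Normalised case (`λ₀ = 1`): the thermal covariance on the circle of period `N + m` tends to
`Σⱼ b₀ⱼ bⱼ₀ λⱼᵐ − b₀₀²` as `N → ∞`. [folklore] -/
theorem toyCov_tendsto_of_top_eq_one (h1 : lam 0 = 1) (hnn : ∀ i, 0 ≤ lam i)
    (hgap : ∀ i, i ≠ 0 → lam i < 1) (m : ℕ) :
    Tendsto (fun N : ℕ =>
        (∑ i, ∑ j, b i j * b j i * lam i ^ N * lam j ^ m) / (∑ i, lam i ^ (N + m))
          - ((∑ i, b i i * lam i ^ (N + m)) / (∑ i, lam i ^ (N + m))) ^ 2) atTop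
      (𝓝 ((∑ j, b 0 j * b j 0 * lam j ^ m) - (b 0 0) ^ 2)) := by
  have hpow := tendsto_pow_eigen h1 hnn hgap
  -- Z(N + m) → 1
  have hZ : Tendsto (fun N : ℕ => ∑ i, lam i ^ (N + m)) atTop (𝓝 1) := by
    have h : Tendsto (fun T : ℕ => ∑ i, lam i ^ T) atTop
        (𝓝 (∑ i : Fin (n + 1), if i = 0 then (1 : ℝ) else 0)) :=
      tendsto_finsetSum _ fun i _ => hpow i
    rw [Finset.sum_ite_eq' Finset.univ (0 : Fin (n + 1)), if_pos (Finset.mem_univ _)] at h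
    exact h.comp (tendsto_add_atTop_nat m)
  -- Tr(b 𝕋ᵀ) → b₀₀
  have hOne : Tendsto (fun N : ℕ => ∑ i, b i i * lam i ^ (N + m)) atTop (𝓝 (b 0 0)) := by
    have h : Tendsto (fun T : ℕ => ∑ i, b i i * lam i ^ T) atTop
        (𝓝 (∑ i : Fin (n + 1), if i = 0 then b 0 0 else 0)) := by
      refine tendsto_finsetSum _ fun i _ => ?_
      have := (hpow i).const_mul (b i i)
      by_cases hi : i = 0
      · subst hi; simpa using this
      · simpa [hi] using this
    rw [Finset.sum_ite_eq' Finset.univ (0 : Fin (n + 1)), if_pos (Finset.mem_univ _)] at h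
    exact h.comp (tendsto_add_atTop_nat m)
  -- Tr(b 𝕋ᴺ b 𝕋ᵐ) → Σⱼ b₀ⱼ bⱼ₀ λⱼᵐ
  have hTwo : Tendsto (fun N : ℕ => ∑ i, ∑ j, b i j * b j i * lam i ^ N * lam j ^ m) atTop
      (𝓝 (∑ j, b 0 j * b j 0 * lam j ^ m)) := by
    have h : Tendsto (fun N : ℕ => ∑ i, ∑ j, b i j * b j i * lam i ^ N * lam j ^ m) atTop
        (𝓝 (∑ i : Fin (n + 1), if i = 0 then ∑ j, b 0 j * b j 0 * lam j ^ m else 0)) := by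
      refine tendsto_finsetSum _ fun i _ => ?_
      have h' : Tendsto (fun N : ℕ => ∑ j, b i j * b j i * lam i ^ N * lam j ^ m) atTop
          (𝓝 (∑ j, b i j * b j i * (if i = 0 then 1 else 0) * lam j ^ m)) := by
        refine tendsto_finsetSum _ fun j _ => ?_
        exact ((hpow i).const_mul (b i j * b j i)).mul_const (lam j ^ m)
      by_cases hi : i = 0
      · subst hi; simpa using h'
      · simpa [hi] using h'
    rw [Finset.sum_ite_eq' Finset.univ (0 : Fin (n + 1)), if_pos (Finset.mem_univ _)] at h
    exact h
  have hT : Tendsto (fun N : ℕ =>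
      (∑ i, ∑ j, b i j * b j i * lam i ^ N * lam j ^ m) / (∑ i, lam i ^ (N + m))) atTop
      (𝓝 (∑ j, b 0 j * b j 0 * lam j ^ m)) := by
    have := hTwo.div hZ one_ne_zero
    rw [div_one] at this
    simpa only [Pi.div_def] using this
  have hO : Tendsto (fun N : ℕ => (∑ i, b i i * lam i ^ (N + m)) / (∑ i, lam i ^ (N + m))) atTop
      (𝓝 (b 0 0)) := by
    have := hOne.div hZ one_ne_zero
    rw [div_one] at this
    simpa only [Pi.div_def] using this
  exact hT.sub (hO.pow 2)

/-- Scale invariance: the thermal covariance depends on the eigenvalues only through `λᵢ/λ₀`. [folklore] -/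
theorem toyCov_normalise (h0 : lam 0 ≠ 0) (m N : ℕ) :
    (∑ i, ∑ j, b i j * b j i * lam i ^ N * lam j ^ m) / (∑ i, lam i ^ (N + m))
        - ((∑ i, b i i * lam i ^ (N + m)) / (∑ i, lam i ^ (N + m))) ^ 2
      = (∑ i, ∑ j, b i j * b j i * (lam i / lam 0) ^ N * (lam j / lam 0) ^ m)
            / (∑ i, (lam i / lam 0) ^ (N + m))
          - ((∑ i, b i i * (lam i / lam 0) ^ (N + m)) / (∑ i, (lam i / lam 0) ^ (N + m))) ^ 2 := by
  have hc : ∀ T : ℕ, (lam 0) ^ T ≠ 0 := fun T => pow_ne_zero T h0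
  have hZ : ∀ T : ℕ, (∑ i, (lam i / lam 0) ^ T) = (∑ i, lam i ^ T) / lam 0 ^ T := by
    intro T; simp [div_pow, Finset.sum_div]
  have hOne : ∀ T : ℕ, (∑ i, b i i * (lam i / lam 0) ^ T) = (∑ i, b i i * lam i ^ T) / lam 0 ^ T := by
    intro T
    rw [Finset.sum_div]
    refine Finset.sum_congr rfl fun i _ => ?_
    rw [div_pow, mul_div_assoc]
  have hTwo : (∑ i, ∑ j, b i j * b j i * (lam i / lam 0) ^ N * (lam j / lam 0) ^ m)
      = (∑ i, ∑ j, b i j * b j i * lam i ^ N * lam j ^ m) / lam 0 ^ (N + m) := by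
    rw [Finset.sum_div]
    refine Finset.sum_congr rfl fun i _ => ?_
    rw [Finset.sum_div]
    refine Finset.sum_congr rfl fun j _ => ?_
    rw [div_pow, div_pow, pow_add]
    field_simp
  rw [hTwo, hOne, hZ, div_div_div_cancel_right₀ (hc (N + m)), div_div_div_cancel_right₀ (hc (N + m))]

/-- **Thermal → vacuum.**  For `λ₀ > λᵢ ≥ 0 (i ≠ 0)` the reflection-positive thermal covariance on the
circle of period `N + m` converges, as `N → ∞`, to the vacuum two-point function
`Σ_{j ≠ 0} b₀ⱼ bⱼ₀ (λⱼ/λ₀)ᵐ` (`= ⟨BΩ, P_Ω^⊥ 𝕋̂ᵐ P_Ω^⊥ BΩ⟩`, `𝕋̂ = 𝕋/λ₀`). [folklore] -/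
theorem toyCov_tendsto (h0 : 0 < lam 0) (hnn : ∀ i, 0 ≤ lam i) (hgap : ∀ i, i ≠ 0 → lam i < lam 0)
    (m : ℕ) :
    Tendsto (fun N : ℕ =>
        (∑ i, ∑ j, b i j * b j i * lam i ^ N * lam j ^ m) / (∑ i, lam i ^ (N + m))
          - ((∑ i, b i i * lam i ^ (N + m)) / (∑ i, lam i ^ (N + m))) ^ 2) atTop
      (𝓝 (∑ j ∈ Finset.univ.erase 0, b 0 j * b j 0 * (lam j / lam 0) ^ m)) := by
  have h1 : (fun i => lam i / lam 0) 0 = 1 := div_self h0.ne'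
  have hnn' : ∀ i, 0 ≤ (fun i => lam i / lam 0) i := fun i => div_nonneg (hnn i) h0.le
  have hgap' : ∀ i, i ≠ 0 → (fun i => lam i / lam 0) i < 1 := fun i hi => (div_lt_one h0).2 (hgap i hi)
  have hlim := toyCov_tendsto_of_top_eq_one (b := b) h1 hnn' hgap' m
  have hval : (∑ j ∈ Finset.univ.erase 0, b 0 j * b j 0 * (lam j / lam 0) ^ m)
      = (∑ j, b 0 j * b j 0 * (lam j / lam 0) ^ m) - b 0 0 ^ 2 := by
    rw [Finset.sum_erase_eq_sub (Finset.mem_univ _), div_self h0.ne', one_pow, mul_one, ← pow_two]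
  rw [hval]
  exact hlim.congr fun N => (toyCov_normalise (b := b) h0.ne' m N).symm

/-- **The zero-temperature floor of the caricature (S2 ⇒ floor).**  If the symmetric slab observable
couples the ground state to some excited state of non-zero eigenvalue, the reflection-positive thermal
covariance has a positive floor for all large periods. [folklore] -/
theorem toy_zeroTemperatureFloor (h0 : 0 < lam 0) (hnn : ∀ i, 0 ≤ lam i)
    (hgap : ∀ i, i ≠ 0 → lam i < lam 0) (hb : ∀ i j, b i j = b j i) (m : ℕ)
    (hcouple : ∃ j, j ≠ 0 ∧ b 0 j ≠ 0 ∧ 0 < lam j) :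
    ∃ ε : ℝ, 0 < ε ∧ ∃ N₀ : ℕ, ∀ N : ℕ, N₀ ≤ N →
      ε ≤ (∑ i, ∑ j, b i j * b j i * lam i ^ N * lam j ^ m) / (∑ i, lam i ^ (N + m))
            - ((∑ i, b i i * lam i ^ (N + m)) / (∑ i, lam i ^ (N + m))) ^ 2 := by
  have hlim := toyCov_tendsto (b := b) h0 hnn hgap m
  have hpos : 0 < ∑ j ∈ Finset.univ.erase 0, b 0 j * b j 0 * (lam j / lam 0) ^ m := by
    obtain ⟨j, hj, hbj, hlj⟩ := hcouple
    apply Finset.sum_pos'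
    · intro i _
      rw [hb i 0, ← pow_two]
      exact mul_nonneg (sq_nonneg _) (pow_nonneg (div_nonneg (hnn i) h0.le) m)
    · refine ⟨j, Finset.mem_erase.2 ⟨hj, Finset.mem_univ _⟩, ?_⟩
      rw [hb j 0, ← pow_two]
      exact mul_pos (pow_pos (abs_pos.2 hbj) 2 |>.trans_eq (sq_abs _)) (pow_pos (div_pos hlj h0) m)
  refine ⟨(∑ j ∈ Finset.univ.erase 0, b 0 j * b j 0 * (lam j / lam 0) ^ m) / 2, half_pos hpos, ?_⟩
  have hev := (tendsto_order.1 hlim).1 _ (half_lt_self hpos)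
  obtain ⟨N₀, hN₀⟩ := eventually_atTop.1 hev
  exact ⟨N₀, fun N hN => (hN₀ N hN).le⟩

/-- **No floor when decoupled.**  If the slab observable does not couple the ground state to any excited
state of non-zero eigenvalue (reflection separation `m ≥ 1`), the thermal covariance tends to `0`: no
positive floor at large periods. [folklore] -/
theorem toy_noFloor (h0 : 0 < lam 0) (hnn : ∀ i, 0 ≤ lam i) (hgap : ∀ i, i ≠ 0 → lam i < lam 0)
    {m : ℕ} (hm : 1 ≤ m) (hdec : ∀ j, j ≠ 0 → b 0 j = 0 ∨ lam j = 0) :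
    ¬ ∃ ε : ℝ, 0 < ε ∧ ∃ N₀ : ℕ, ∀ N : ℕ, N₀ ≤ N →
      ε ≤ (∑ i, ∑ j, b i j * b j i * lam i ^ N * lam j ^ m) / (∑ i, lam i ^ (N + m))
            - ((∑ i, b i i * lam i ^ (N + m)) / (∑ i, lam i ^ (N + m))) ^ 2 := by
  have hlim := toyCov_tendsto (b := b) h0 hnn hgap m
  have hzero : (∑ j ∈ Finset.univ.erase 0, b 0 j * b j 0 * (lam j / lam 0) ^ m) = 0 := by
    refine Finset.sum_eq_zero fun j hj => ?_
    rcases hdec j (Finset.mem_erase.1 hj).1 with h | h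
    · simp [h]
    · have hm0 : m ≠ 0 := by omega
      simp [h, zero_pow hm0]
  rw [hzero] at hlim
  rintro ⟨ε, hε, N₀, hN₀⟩
  have : ε ≤ 0 := ge_of_tendsto hlim (eventually_atTop.2 ⟨N₀, hN₀⟩)
  linarith

/-- **The caricature decided.**  For a symmetric slab observable and reflection separation `m ≥ 1`:
a positive zero-temperature floor holds for all large periods IFF the observable couples the ground
state to an excited state of non-zero eigenvalue. [folklore] -/
theorem toy_floor_iff (h0 : 0 < lam 0) (hnn : ∀ i, 0 ≤ lam i) (hgap : ∀ i, i ≠ 0 → lam i < lam 0)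
    (hb : ∀ i j, b i j = b j i) {m : ℕ} (hm : 1 ≤ m) :
    (∃ ε : ℝ, 0 < ε ∧ ∃ N₀ : ℕ, ∀ N : ℕ, N₀ ≤ N →
      ε ≤ (∑ i, ∑ j, b i j * b j i * lam i ^ N * lam j ^ m) / (∑ i, lam i ^ (N + m))
            - ((∑ i, b i i * lam i ^ (N + m)) / (∑ i, lam i ^ (N + m))) ^ 2) ↔
      ∃ j, j ≠ 0 ∧ b 0 j ≠ 0 ∧ 0 < lam j := by
  constructor
  · intro hfl
    by_contra hno
    simp only [not_exists, not_and, not_lt] at hno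
    refine toy_noFloor (b := b) h0 hnn hgap hm (fun j hj => ?_) hfl
    by_cases hbj : b 0 j = 0
    · exact Or.inl hbj
    · exact Or.inr (le_antisymm (hno j hj hbj) (hnn j))
  · exact toy_zeroTemperatureFloor h0 hnn hgap hb m

end Toy

end Summit.QuantumFields.YangMills.Theorems.ThermalDescent

end
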